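import Summits.HodgeConjecture.HodgeConjecture.Theorems.EndoscopicMiddleDegreeOrthogonalEnvelopedFiniteIndexHeckeLevel

/-!
# Stub `stub_exists_deepLevel` (H3 of line `purity-sorted-hecke-envelope`, crux
# `EndoscopicMiddleDegree.OrthogonalEnveloped`, stmt-HodgeConjecture-14300): a common deep level for
# two Hecke correspondences

Registered skeleton: `PuritySortedHeckeEnvelope` of crux `OrthogonalEnveloped`; this is the file
`Theorems/EndoscopicMiddleDegreeOrthogonalEnvelopedDeepLevel.lean` of the summit
(`--supports stmt-HodgeConjecture-14300`).

WHAT IS PROVED. For a compact ball quotient datum `D` (`Γ = D.Γ`), isometries `g, h ∈ U(V)(F)` with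
`[Γ : N_h] < ∞` and any map `s : Γ / N_h → Γ` (a choice of representatives `γ_{q'} = s q'`), there is a
normal subgroup `M ⊴ Γ` of finite index with `M ≤ N_g` (so `g M g⁻¹ ⊆ Γ`), `g M g⁻¹ ⊆ N_h`, and
`M ≤ N_{h γ_{q'} g}` for every `q'`; here `N_y` is the Hecke level of `y` (the normal core in `Γ` of
`Γ ∩ y⁻¹Γy`, `UnitaryBallQuotientDatum.heckeLevel`). The lead reads the product `T_g T_h` of Hecke
operators on the level cover `M \ 𝔹` (Shimura's Hecke ring, Prop. 3.1).

Proof (pure group theory, Shimura 1971 §3.1: `U(V)(F)` commensurates `Γ`). Conjugation by `g` is a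
group hom `φ : Γ ∩ g⁻¹Γg → Γ`; the subgroup `C = φ⁻¹(N_h) = {γ ∈ Γ ∩ g⁻¹Γg | g γ g⁻¹ ∈ N_h}` has finite
index in `Γ`: `[Γ ∩ g⁻¹Γg : C] = [φ(Γ ∩ g⁻¹Γg) : φ(Γ ∩ g⁻¹Γg) ∩ N_h] ≤ [Γ : N_h]`
(`Subgroup.index_comap`, `Subgroup.instFiniteIndex_subgroupOf`) and `[Γ : Γ ∩ g⁻¹Γg] ≤ [Γ : N_g] < ∞`
(`stub_finiteIndexHeckeLevel`, landed). Every `N_{h γ_{q'} g}` has finite index by the same stub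
(`h γ_{q'} g ∈ U(V)(F)` since `Γ ≤ U(V)(F)`), and `Γ / N_h` is finite, so
`K = N_g ∩ C ∩ ⋂_{q'} N_{h γ_{q'} g}` has finite index (`Subgroup.finiteIndex_iInf`); its normal core
`M` (`Subgroup.normalCore`, finite index by `Subgroup.finiteIndex_normalCore`) is the required level.

Source: G. Shimura, *Introduction to the arithmetic theory of automorphic functions* (1971), §3.1
Prop. 3.1 and §3.2 Lemma 3.9.
-/

noncomputable section

-- The crux-workfile namespace `Summit.<P>.<Sub>.Cruxes.…` repeats `HodgeConjecture` (single-conjunct summit).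
set_option linter.dupNamespace false

namespace Summit.HodgeConjecture.HodgeConjecture.Cruxes.OrthogonalEnveloped.PuritySortedHeckeEnvelope

open Literature.AlgebraicGeometry.Motives (SchemeOver)
open Literature.AlgebraicGeometry.ShimuraVarieties
open Summit.HodgeConjecture.HodgeConjecture.Cruxes.OrthogonalEnveloped.HeckeGraphChow
  (stub_finiteIndexHeckeLevel)

/-- **Stub H3 — a common deep level.** For `g, h ∈ U(V)(F)` and a section `s` of `Γ → Γ/N_h` there is a
normal subgroup `M ⊴ Γ` of finite index inside `N_g`, with `g M g⁻¹ ⊆ N_h`, and inside every Hecke level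
`N_{h γ_{q'} g}` (`γ_{q'} = s q'`): the normal core of the (finite) intersection of these finite-index subgroups
(`U(V)(F)` commensurates `Γ`: `stub_finiteIndexHeckeLevel`; `[Γ ∩ g⁻¹Γg : Γ ∩ g⁻¹ N_h g] ≤ [Γ : N_h]`).
[cite: Shimura1973, §3.1 Prop. 3.1 and Lemma 3.9] -/
theorem stub_exists_deepLevel :
    ∀ {p : ℕ} {X : SchemeOver ℂ} (D : UnitaryBallQuotientDatum p X) (g h : GL (Fin (p + 1)) D.E),
      g ∈ unitaryGroup (conjRingHom D.E) D.H → h ∈ unitaryGroup (conjRingHom D.E) D.H →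
      ∀ [(D.heckeLevel h).FiniteIndex] (s : ↥D.Γ ⧸ D.heckeLevel h → ↥D.Γ),
      ∃ (M : Subgroup ↥D.Γ) (_ : M.Normal) (_ : M.FiniteIndex)
        (hMg : ∀ γ ∈ M, g * (γ : GL (Fin (p + 1)) D.E) * g⁻¹ ∈ D.Γ),
        M ≤ D.heckeLevel g ∧
        (∀ γ (hγ : γ ∈ M),
          (⟨g * (γ : GL (Fin (p + 1)) D.E) * g⁻¹, hMg γ hγ⟩ : ↥D.Γ) ∈ D.heckeLevel h) ∧
        ∀ q', M ≤ D.heckeLevel (h * (s q' : GL (Fin (p + 1)) D.E) * g) := by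
  intro p X D g h hg hh _ s
  haveI : (D.heckeLevel g).FiniteIndex := stub_finiteIndexHeckeLevel D g hg
  haveI : (D.heckeStabilizer g).FiniteIndex := Subgroup.finiteIndex_of_le (D.heckeLevel_le g)
  -- Step 1: `C = {γ ∈ Γ ∩ g⁻¹Γg | g γ g⁻¹ ∈ N_h}` has finite index in `Γ`
  obtain ⟨C, hC, hCmem⟩ : ∃ C : Subgroup ↥D.Γ, C.FiniteIndex ∧
      ∀ γ ∈ C, ∃ hγ : g * (γ : GL (Fin (p + 1)) D.E) * g⁻¹ ∈ D.Γ,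
        (⟨g * (γ : GL (Fin (p + 1)) D.E) * g⁻¹, hγ⟩ : ↥D.Γ) ∈ D.heckeLevel h := by
    -- the conjugation hom `φ : Γ ∩ g⁻¹Γg →* Γ`, `γ ↦ g γ g⁻¹`
    let φ : ↥(D.heckeStabilizer g) →* ↥D.Γ := MonoidHom.mk'
      (fun γ ↦ ⟨g * ((γ : ↥D.Γ) : GL (Fin (p + 1)) D.E) * g⁻¹,
        (D.mem_heckeStabilizer_iff g _).1 γ.2⟩)
      fun a b ↦ Subtype.ext <| by
        simp only [Subgroup.coe_mul]
        group
    have hφ : ((D.heckeLevel h).comap φ).FiniteIndex := ⟨by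
      rw [Subgroup.index_comap]
      exact (Subgroup.instFiniteIndex_subgroupOf (D.heckeLevel h) φ.range).index_ne_zero⟩
    refine ⟨((D.heckeLevel h).comap φ).map (D.heckeStabilizer g).subtype, ⟨?_⟩, ?_⟩
    · rw [Subgroup.index_map_subtype]
      exact mul_ne_zero hφ.index_ne_zero Subgroup.FiniteIndex.index_ne_zero
    · rintro _ ⟨x, hx, rfl⟩
      exact ⟨(D.mem_heckeStabilizer_iff g _).1 x.2, Subgroup.mem_comap.1 hx⟩
  -- Step 2: the Hecke levels `N_{h γ_{q'} g}` have finite index, and `Γ / N_h` is finite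
  have hq : ∀ q', (D.heckeLevel (h * (s q' : GL (Fin (p + 1)) D.E) * g)).FiniteIndex := fun q' ↦
    stub_finiteIndexHeckeLevel D _ (mul_mem (mul_mem hh (D.isCongruenceSubgroup.1 (s q').2)) hg)
  haveI : (⨅ q', D.heckeLevel (h * (s q' : GL (Fin (p + 1)) D.E) * g)).FiniteIndex :=
    Subgroup.finiteIndex_iInf hq
  -- Step 3: the finite intersection `K = N_g ∩ C ∩ ⋂_{q'} N_{h γ_{q'} g}`
  obtain ⟨K, hK, hKg, hKC, hKq⟩ : ∃ K : Subgroup ↥D.Γ, K.FiniteIndex ∧ K ≤ D.heckeLevel g ∧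
      K ≤ C ∧ ∀ q', K ≤ D.heckeLevel (h * (s q' : GL (Fin (p + 1)) D.E) * g) :=
    ⟨D.heckeLevel g ⊓ C ⊓ ⨅ q', D.heckeLevel (h * (s q' : GL (Fin (p + 1)) D.E) * g),
      inferInstance, inf_le_left.trans inf_le_left, inf_le_left.trans inf_le_right,
      fun q' ↦ inf_le_right.trans (iInf_le _ q')⟩
  -- Step 4: its normal core `M`
  refine ⟨K.normalCore, inferInstance, inferInstance,
    fun γ hγ ↦ D.conj_mem_of_mem_heckeLevel g (hKg (K.normalCore_le hγ)),
    K.normalCore_le.trans hKg, fun γ hγ ↦ ?_, fun q' ↦ K.normalCore_le.trans (hKq q')⟩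
  obtain ⟨_, hmem⟩ := hCmem γ (hKC (K.normalCore_le hγ))
  exact hmem

end Summit.HodgeConjecture.HodgeConjecture.Cruxes.OrthogonalEnveloped.PuritySortedHeckeEnvelope

end
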